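import Literature.MathematicalPhysics.QuantumFieldTheory.Balaban1983to89.B1Eq230FluctCov
import Literature.MathematicalPhysics.QuantumFieldTheory.Balaban1983to89.B2Restr216Lattice

/-!
# `Balaban1983to89.B1Eq243HiggsModel` — T. Bałaban, *(Higgs)₂,₃ quantum fields in a finite volume. I. A lower bound*,
Commun. Math. Phys. **85** (1982) 603–626 [Balaban1982Higgs1]: the renormalization group equations (2.41), (2.42) and their
solved form (2.43) (= [Balaban1983RegularityDecay] (2.34)) PROVED for the CONCRETE gauge-covariant operators of the model —
the propagators `G^ε_k(Ω, A)` (2.20) of `…HiggsCovariance` for an ARBITRARY external vector field `A`, an arbitrary region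
`Ω ⊂ T_ε` (Neumann boundary conditions) and an arbitrary coupling `U(A) = exp(qεeA)` when m² > 0, and on the whole torus
`Ω = T_ε` in the full printed range m² ≥ 0 of [Balaban1983RegularityDecay] (1.6) (existence of `G^ε_k(T_ε, A)` at m² = 0
PROVED: a kernel vector is covariantly constant with vanishing block averages, hence zero)

statement-level skeleton of published theorems with citation tags; proofs where landed; nothing here is a claim about the Yang–Mills mass gap

PDF held: `paper:balaban1982-cmp85-higgs23-i` (journal page = PDF page + 602); pp. 608–612 [PDF 6–10] read AS IMAGES from
the ×2 renders `run/shared/lean/pub/pub-balaban/b2b-balaban-ref1/pages/1982-cmp85-higgs23-I/1982-cmp85-higgs23-I-p006…p010-x2.png`;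
[Balaban1983RegularityDecay] pp. 572, 582 [PDF 2, 12] from `…/1983-cmp89-regularity-decay/1983-cmp89-regularity-decay-p002-x2.png`,
`…-p012-x2.png`.

CITATION HEADER (lean-in-tree rule) — WHAT IS REPRODUCED.  Cell `lit-balaban` (HOME `run/shared/lean/pub/lit-balaban/`),
Phase-2 proof seat p35 (gen 3), FILE 3 of 3 (file 1 `B1Eq27StepAdjoint`: one-step `Q(A)`, `Q^*(A)`, `QQ^* = 1`,
`Q_{k+1} = QQ_k`; file 2 `B1Eq230FluctCov`: `Δ^{(j)}(Ω,A)`, `C^{(j)}(Ω,A)`, the `B1RG242.StepData` of the model with its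
hypotheses proved).  SKELETON rows **B1.Eq2.41** ((2.41)/(2.42)) and **B1.Eq2.43** (= B4 row **B4.Eq2.34**) — and, for the massless range on
the torus, the existence half of **B4.Eq1.6** on the typer's `HiggsCovariance` carriers (the row's record typing
`B4GaugeCovariance.covOp/green` lives on another carrier family and is not touched) — so far
`proved-existing` only ABSTRACTLY (`B1RG242`: QQ^* = 1, Q_{k+1} = QQ_k, Q^*_{k+1} = Q^*_kQ^*, adjointness for (1.5) and
existence of the inverses (2.20)/(2.30) as HYPOTHESES) and for `U = 1` on the whole torus (`B1RG242Torus`, whose NOT-CERTIFIED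
(i) reads *"The GAUGE-COVARIANT operators … are NOT constructed"* and (ii) *"Only the WHOLE TORUS"*).  Here the printed
identities are THEOREMS for the typer's concrete operators `HiggsCovariance.avgQkLin/avgQkAdj/covOpK/propagatorK` (general
`A`, `Ω`, `ChargeData`) — `B1RG242.StepData.display242`/`display241_printed` consumed BY NAME with all hypotheses discharged in
file 2; nothing of those modules is restated.
PRINT, verbatim (p. 612 [PDF 10]): *"Now we will find recursive relations between the propagators (2.20), (2.30). Using the
relations (2.18), (2.19), (2.21), we get after easy calculations … Q_{k+1}(A)G^ε_{k+1}(Ω,A) = (aa_k/a_{k+1})(L^kε)^{−2}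
Q(A)C^{(k),L^kε}(Ω,A)Q_k(A)G^ε_k(Ω,A), (2.41)  G^ε_{k+1}(Ω,A) = a_k²(L^kε)^{−4}G^ε_k(Ω,A)Q^*_k(A)C^{(k),L^kε}(Ω,A)Q_k(A)G^ε_k(Ω,A)
+ G^ε_k(Ω,A). (2.42) … More exactly, an equality obtained by solving (2.42), i.e. applying (2.42) k times, has such a meaning.
Using the identity G^ε_1(Ω,A) = C^{(0),ε}(Ω,A), we get G^ε_k(Ω,A) = Σ_{j=1}^{k−1} a_j²(L^jε)^{−4}
G^ε_j(Ω,A)Q^*_j(A)C^{(j),L^jε}(Ω,A)Q_j(A)G^ε_j(Ω,A) + C^{(0),ε}(Ω,A). (2.43)"*; p. 610 [PDF 8]: *"Let us notice that the rescaled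
propagator is given by G_k(Ω,A) = (−Δ^{η,N}_{A,Ω} + m²(L^kε)² + a_kP_k(A))^{−1}. (2.22)"*; [Balaban1983RegularityDecay] p. 582
[PDF 12]: *"This proof is based on renormalization group equations (2.43) of [1] rescaled to the η-lattice: G_k(□) = C^{(0),η}(□)
+ Σ_{j=1}^{k−1} a_j²(L^jη)^{−4}G^η_j(□)Q^*_jC^{(j),L^jη}(□)Q_jG^η_j(□). (2.34)"*; p. 572 [PDF 2]: *"Our fundamental Green's function
is a kernel of the operator G_k(Ω, A) = (−Δ^{η,N}_{A,Ω} + m² + aP_k(A))^{−1}, (1.6) where m² ≧ 0 and a is a positive constant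
close to 1."*, with (1.3) *"⟨φ,(−Δ^{η,N}_{A,Ω})φ⟩ = Σ_{b⊂Ω} η^d|(D^η_Aφ)(b)|²"*, (1.4) *"(Q_k(A)φ)(y) = Σ_{x∈B^k(y)} η^dU(A(Γ^{(k)}_{y,x}))φ(x)"*
and (1.5) *"P_k(A) = Q^*_k(A)Q_k(A)"*.

WHAT THIS FILE PROVES (0 sorry; axioms ⊆ {propext, Classical.choice, Quot.sound}; theorems only), for a > 0, L > 1, every
`C : ChargeData N`, every `A : VecField P 0`, every `Ω : Finset (Site P 0)`:
* the identities FROM THE EXISTENCE of the propagators alone, m² ≥ 0: `display242_of_isUnit`, `display241_of_isUnit` (1 ≤ j < K,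
  given `G^ε_j`, `G^ε_{j+1}` exist), `display243_of_isUnit` (1 ≤ k ≤ K, given `G^ε_1 … G^ε_k` exist), and *"It is so"* from the
  existence of `G^ε_{j+1}` (`isUnit_precOpA_of_next`, `stepData_C_arg_of_next`);
* UNCONDITIONALLY for m² > 0 (`HiggsCovariancePos.isUnit_covOpK_of_pos`): **(2.42)** `display242_model` and **(2.41)**
  `display241_model` (printed coefficients `a_j²(L^jε)^{−4}` = `coeff221 P a j ^ 2`, `(aa_j/a_{j+1})(L^jε)^{−2}`), 1 ≤ j < K;
* `propagatorK_one` : G^ε_1(Ω,A) = C^{(0),ε}(Ω,A) (a_1 = a, Q_1 = Q: `B1.aSeq_one`, `B1Eq27StepAdjoint.avgQkLin_one/avgQkAdj_one`);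
* **(2.43)** `display243_model`, 1 ≤ k ≤ K (finite telescoping `telescope` over the paper's levels), and **B4 (2.34)**
  `display234_rescaled`: the same for the rescaled propagators (2.22) (`HiggsCovariance.propagatorRescaled`, η-lattice
  parameters `P.unitAt k`, mass m²(L^kε)²) — B4's one-component `G_k(□) = G_k(□,0)` is the case `A = 0`, `Ω = □`;
  `coeff221_sq` (the printed coefficient);
* THE MASSLESS RANGE ON THE WHOLE TORUS (§5–§7), m² ≥ 0, `Ω = T_ε`: (§5) covariantly constant fields (`D^ε_Aφ = 0` on every
  bond) are carried to their endpoint values by the transports along the staircase / composite contours (2.1)/(2.2)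
  (`U_contourSum_apply_of_covDeriv_eq_zero`, `U_multiContourSum_apply_of_covDeriv_eq_zero` — the case p = 0 of p17's
  telescoping estimate `B2Restr216Lattice.norm_U_contourSum_cornerN_sub_le`), so `(Q_k(A)φ)(y) = L^{−kd}|B^k(y)|φ(y)`
  (`avgQkLin_apply_of_covDeriv_eq_zero`); (§6) the form identity `⟨φ, (−Δ^{ε,N}_{A,Ω} + m² + a_k(L^kε)^{−2}P_k(A))φ⟩ =
  ⟨φ,−Δφ⟩ + m²|φ|² + a_k(L^kε)^{−2}|Q_k(A)φ|²` (`siteInner_covOpK_eq`), whence on `T_ε` a kernel vector is covariantly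
  constant with `Q_k(A)φ = 0` (`covDeriv_eq_zero_of_covOpK_univ_eq_zero`), vanishes at every block point and therefore
  everywhere: **B4 (1.6) = (2.20) EXISTS on `T_ε` for m² ≥ 0, a_k > 0, EVERY `A`** (`covOpK_univ_injective`,
  `isUnit_covOpK_univ`, `isUnit_covOpK_univ_of_pos`, `propagatorK_mul_covOpK_univ`, `covOpK_mul_propagatorK_univ`);
  (§7) **(2.42)** `display242_univ`, **(2.41)** `display241_univ`, **(2.43)** `display243_univ`, **B4 (2.34)**
  `display234_rescaled_univ` for m² ≥ 0 on the torus.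
HONEST SCOPE.  (a) For a PROPER region Ω ⊊ T_ε only m² > 0 is covered: the typer's operator acts on all fields on `T_ε`
with the bonds outside Ω dropped, and at m² = 0 it has a kernel (fields supported off Ω with vanishing block averages) —
the printed `G_k(Ω,A)`, Ω ⊊ T, acts on φ : Ω → R^N, a carrier not built here (B5's massless (1.135) with U = 1 on the
torus IS `B1RG242Torus`; the covariant massless torus case is §7 here).  (b) Levels 1 ≤ k ≤ K, exactly the paper's.
(c) Nothing quantitative (Prop. 2.3 (2.33), B4 Prop. 1.1 / Lemma 2.4) is touched; no size condition on `A` is used.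
Value = kernel certificate that the located *"easy calculations"* (2.41)–(2.43) hold for Bałaban's actual covariant
operators with external field, in B4's printed range m² ≥ 0 on the torus; NOT summit progress.  Unit `lit-balaban-p35` gen 3.
-/

open scoped BigOperators InnerProductSpace Matrix

namespace Literature.MathematicalPhysics.QuantumFieldTheory.Balaban1983to89.B1Eq243HiggsModel

open HiggsLattice HiggsAveraging HiggsAveragingCompose HiggsCovariance HiggsCovariancePos B1Eq27StepAdjoint
  B1Eq221Coordinates HiggsFluctMeasure B1Eq230FluctCov B2Restr216Lattice

variable {P : HiggsLattice.Params} {N : ℕ}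

/-! ## §4 (2.42), (2.41) and (2.43) = B4 (2.34) for the concrete covariant propagators -/

section RG

variable (C : ChargeData N) (Ω : Finset (HiggsLattice.Site P 0)) (A : HiggsLattice.VecField P 0) {msq a : ℝ}

/-! ### The step hypotheses of `B1RG242` from the EXISTENCE of `G^ε_j`, `G^ε_{j+1}` alone (m² ≥ 0) -/

/-- Existence of `C^{(j),L^jε}(Ω,A)` from the existence of `G^ε_{j+1}(Ω,A)` (m² ≥ 0, a > 0, L > 1, 1 ≤ j): the step-data form
of `B1RG242.StepData.isUnit_C_of_next` for the model. [cite: Balaban1982Higgs1, (2.30) p.611] -/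
theorem stepData_C_arg_of_next (hm : 0 ≤ msq) (ha : 0 < a) (hL : 1 < (P.L : ℝ)) {j : ℕ} (hj : 1 ≤ j)
    (hnext : IsUnit (covOpK C Ω A msq a (j + 1))) :
    IsUnit ((stepData C Ω A msq a j).β • (stepData C Ω A msq a j).P + (stepData C Ω A msq a j).Δk) := by
  refine B1RG242.StepData.isUnit_C_of_next (stepData_scalarProducts C Ω A hm ha hL hj) ?_
  rw [stepData_next_arg_eq C Ω A msq ha hL hj, isUnit_mat_iff]
  exact hnext

/-- *"It is so"* (p. 611) from the existence of `G^ε_{j+1}` alone: `a(L^{j+1}ε)^{−2}P(A) + Δ^{(j),L^jε}(Ω,A)` is invertible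
(m² ≥ 0, 1 ≤ j). [cite: Balaban1982Higgs1, (2.30) p.611] -/
theorem isUnit_precOpA_of_next (hm : 0 ≤ msq) (ha : 0 < a) (hL : 1 < (P.L : ℝ)) {j : ℕ} (hj : 1 ≤ j)
    (hnext : IsUnit (covOpK C Ω A msq a (j + 1))) : IsUnit (precOpA C Ω A msq a j : Module.End ℝ (ScalarField P j N)) := by
  obtain ⟨i, rfl⟩ : ∃ i, j = i + 1 := ⟨j - 1, by omega⟩
  rw [← isUnit_mat_iff, ← stepData_C_arg_eq]
  exact stepData_C_arg_of_next C Ω A hm ha hL hj hnext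

/-- **(2.42) from the existence of `G^ε_j` and `G^ε_{j+1}`** (m² ≥ 0, a > 0, L > 1, 1 ≤ j < K; every `A`, `Ω`, `C`):
`G^ε_{j+1}(Ω,A) = a_j²(L^jε)^{−4}·G^ε_j(Ω,A)Q^*_j(A)C^{(j),L^jε}(Ω,A)Q_j(A)G^ε_j(Ω,A) + G^ε_j(Ω,A)` (`a_j²(L^jε)^{−4}` =
`coeff221 P a j ^ 2`) — `B1RG242.StepData.display242` with its structural hypotheses discharged. [cite: Balaban1982Higgs1, (2.42) p.612] -/
theorem display242_of_isUnit (hm : 0 ≤ msq) (ha : 0 < a) (hL : 1 < (P.L : ℝ)) {j : ℕ} (hj : 1 ≤ j) (hjK : j < P.K)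
    (hG : IsUnit (covOpK C Ω A msq a j)) (hG1 : IsUnit (covOpK C Ω A msq a (j + 1))) :
    propagatorK C Ω A msq a (j + 1)
      = (coeff221 P a j ^ 2) • (propagatorK C Ω A msq a j ∘ₗ avgQkAdj C A j ∘ₗ fluctCovA C Ω A msq a j
          ∘ₗ avgQkLin C A j ∘ₗ propagatorK C Ω A msq a j) + propagatorK C Ω A msq a j := by
  obtain ⟨i, rfl⟩ : ∃ i, j = i + 1 := ⟨j - 1, by omega⟩
  set S := stepData C Ω A msq a (i + 1) with hS
  have hGm : IsUnit (S.H + S.α • S.Pk) := by rw [hS, stepData_G_arg_eq, isUnit_mat_iff]; exact hG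
  have h242 := B1RG242.StepData.display242 S (stepData_QQs C Ω A msq a hjK)
    (stepData_scalarProducts C Ω A hm ha hL hj).αβ_ne hGm (stepData_C_arg_of_next C Ω A hm ha hL hj hG1)
  have hG1m : S.Gk1 = mat (propagatorK C Ω A msq a (i + 1 + 1)) := by
    rw [B1RG242.StepData.Gk1, hS, stepData_next_arg_eq C Ω A msq ha hL hj, propagatorK, mat_inverse]
  apply mat_injective
  rw [← hG1m, h242, mat_add, mat_smul, mat_comp, mat_comp, mat_comp, mat_comp, hS, stepData_Gk, stepData_Ck]
  show coeff221 P a (i + 1) ^ 2 • _ + _ = _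
  simp only [Matrix.mul_assoc]
  rfl

/-- **(2.41) from the existence of `G^ε_j` and `G^ε_{j+1}`**: `Q_{j+1}(A)G^ε_{j+1}(Ω,A) = (aa_j/a_{j+1})(L^jε)^{−2}·
Q(A)C^{(j),L^jε}(Ω,A)Q_j(A)G^ε_j(Ω,A)` (`B1RG242.StepData.display241_printed`). [cite: Balaban1982Higgs1, (2.41) p.612] -/
theorem display241_of_isUnit (hm : 0 ≤ msq) (ha : 0 < a) (hL : 1 < (P.L : ℝ)) {j : ℕ} (hj : 1 ≤ j) (hjK : j < P.K)
    (hG : IsUnit (covOpK C Ω A msq a j)) (hG1 : IsUnit (covOpK C Ω A msq a (j + 1))) :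
    avgQkLin C A (j + 1) ∘ₗ propagatorK C Ω A msq a (j + 1)
      = (a * B1.aSeq a P.L j / B1.aSeq a P.L (j + 1) * (P.mesh j ^ 2)⁻¹) •
          (avgQLin C A j ∘ₗ fluctCovA C Ω A msq a j ∘ₗ avgQkLin C A j ∘ₗ propagatorK C Ω A msq a j) := by
  obtain ⟨i, rfl⟩ : ∃ i, j = i + 1 := ⟨j - 1, by omega⟩
  set S := stepData C Ω A msq a (i + 1) with hS
  have hmesh : P.mesh (i + 1 + 1) = P.L * P.mesh (i + 1) := by unfold HiggsLattice.Params.mesh; rw [pow_succ]; ring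
  have hGm : IsUnit (S.H + S.α • S.Pk) := by rw [hS, stepData_G_arg_eq, isUnit_mat_iff]; exact hG
  have h241 := B1RG242.StepData.display241_printed S ha hL hj (P.mesh_pos (i + 1)) (stepData_QQs C Ω A msq a hjK)
    hGm (stepData_C_arg_of_next C Ω A hm ha hL hj hG1)
    (show S.α = B1.aSeq a P.L (i + 1) * (P.mesh (i + 1) ^ 2)⁻¹ by
      rw [hS]; show coeff221 P a (i + 1) = _; rw [coeff221_eq, inv_pow])
    (show S.β = a * ((P.L * P.mesh (i + 1)) ^ 2)⁻¹ by
      rw [hS]; show a * ((P.mesh (i + 1 + 1))⁻¹ ^ 2) = _; rw [inv_pow, hmesh])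
  have hG1m : S.Gk1 = mat (propagatorK C Ω A msq a (i + 1 + 1)) := by
    rw [B1RG242.StepData.Gk1, hS, stepData_next_arg_eq C Ω A msq ha hL hj, propagatorK, mat_inverse]
  apply mat_injective
  rw [mat_comp, ← hG1m, ← stepData_Qk1 C Ω A msq a, h241, mat_smul, mat_comp, mat_comp, mat_comp, hS, stepData_Gk,
    stepData_Ck]
  simp only [Matrix.mul_assoc]
  rfl

/-- **`G^ε_1(Ω,A) = C^{(0),ε}(Ω,A)`** (p. 612: *"Using the identity G^ε_1(Ω,A) = C^{(0),ε}(Ω,A)"*): (2.20) at k = 1 (a_1 = a,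
`B1.aSeq_one`; Q_1 = Q, `B1Eq27StepAdjoint.avgQkLin_one/avgQkAdj_one`) is (2.30) at k = 0 with (2.17) — an identity of the
defining expressions, valid for every m². [cite: Balaban1982Higgs1, (2.43) p.612] -/
theorem propagatorK_one (hL : 1 < (P.L : ℝ)) (msq a : ℝ) : propagatorK C Ω A msq a 1 = fluctCovA C Ω A msq a 0 := by
  have h : covOpK C Ω A msq a 1 = precOpA C Ω A msq a 0 := by
    rw [covOpK, precOpA, deltaKA_zero, delta0, blockProjA, projPk, avgQkLin_one, avgQkAdj_one, B1.aSeq_one hL, add_comm]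
  rw [propagatorK, fluctCovA, h]

/-- Finite telescoping: `G_{j+1} = T_j + G_j` for 1 ≤ j < k gives `G_k = Σ_{j=1}^{k−1} T_j + G_1` (the tree's
`B1.display243_of_242` asks the recursion for all j; here only the paper's levels are available). [cite: Balaban1982Higgs1, (2.43) p.612] -/
theorem telescope {R : Type*} [AddCommMonoid R] (G T : ℕ → R) {k : ℕ} (hk : 1 ≤ k)
    (h : ∀ j, 1 ≤ j → j < k → G (j + 1) = T j + G j) : G k = (∑ j ∈ Finset.Ico 1 k, T j) + G 1 := by
  induction k, hk using Nat.le_induction with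
  | base => simp
  | succ n hn ih =>
    rw [h n hn (Nat.lt_succ_self n), ih fun j hj hjn => h j hj (Nat.lt_succ_of_lt hjn), Finset.sum_Ico_succ_top hn]
    abel

/-- **(2.43) from the existence of `G^ε_1, …, G^ε_k`** (m² ≥ 0, a > 0, L > 1, 1 ≤ k ≤ K; every `A`, `Ω`, `C`):
`G^ε_k(Ω,A) = Σ_{j=1}^{k−1} a_j²(L^jε)^{−4} G^ε_jQ^*_jC^{(j),L^jε}Q_jG^ε_j + C^{(0),ε}(Ω,A)`. [cite: Balaban1982Higgs1, (2.43) p.612] -/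
theorem display243_of_isUnit (hm : 0 ≤ msq) (ha : 0 < a) (hL : 1 < (P.L : ℝ)) {k : ℕ} (hk : 1 ≤ k) (hkK : k ≤ P.K)
    (hG : ∀ j, 1 ≤ j → j ≤ k → IsUnit (covOpK C Ω A msq a j)) :
    propagatorK C Ω A msq a k
      = (∑ j ∈ Finset.Ico 1 k, (coeff221 P a j ^ 2) •
          (propagatorK C Ω A msq a j ∘ₗ avgQkAdj C A j ∘ₗ fluctCovA C Ω A msq a j ∘ₗ avgQkLin C A j
            ∘ₗ propagatorK C Ω A msq a j))
        + fluctCovA C Ω A msq a 0 := by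
  rw [← propagatorK_one C Ω A hL msq a]
  exact telescope (fun j => propagatorK C Ω A msq a j) _ hk fun j hj hjk =>
    display242_of_isUnit C Ω A hm ha hL hj (by omega) (hG j hj hjk.le) (hG (j + 1) (by omega) (by omega))

/-! ### The massive case m² > 0: every region `Ω`, UNCONDITIONALLY (`HiggsCovariancePos.isUnit_covOpK_of_pos`) -/

/-- **(2.42) FOR THE CONCRETE MODEL**, m² > 0, a > 0, L > 1, 1 ≤ j < K, every `A`, `Ω`, `C`. [cite: Balaban1982Higgs1, (2.42) p.612] -/
theorem display242_model (hm : 0 < msq) (ha : 0 < a) (hL : 1 < (P.L : ℝ)) {j : ℕ} (hj : 1 ≤ j) (hjK : j < P.K) :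
    propagatorK C Ω A msq a (j + 1)
      = (coeff221 P a j ^ 2) • (propagatorK C Ω A msq a j ∘ₗ avgQkAdj C A j ∘ₗ fluctCovA C Ω A msq a j
          ∘ₗ avgQkLin C A j ∘ₗ propagatorK C Ω A msq a j) + propagatorK C Ω A msq a j :=
  display242_of_isUnit C Ω A hm.le ha hL hj hjK (isUnit_covOpK_of_pos C Ω A hm ha hL hj)
    (isUnit_covOpK_of_pos C Ω A hm ha hL (by omega))

/-- **(2.41) FOR THE CONCRETE MODEL**, m² > 0, a > 0, L > 1, 1 ≤ j < K, every `A`, `Ω`, `C`. [cite: Balaban1982Higgs1, (2.41) p.612] -/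
theorem display241_model (hm : 0 < msq) (ha : 0 < a) (hL : 1 < (P.L : ℝ)) {j : ℕ} (hj : 1 ≤ j) (hjK : j < P.K) :
    avgQkLin C A (j + 1) ∘ₗ propagatorK C Ω A msq a (j + 1)
      = (a * B1.aSeq a P.L j / B1.aSeq a P.L (j + 1) * (P.mesh j ^ 2)⁻¹) •
          (avgQLin C A j ∘ₗ fluctCovA C Ω A msq a j ∘ₗ avgQkLin C A j ∘ₗ propagatorK C Ω A msq a j) :=
  display241_of_isUnit C Ω A hm.le ha hL hj hjK (isUnit_covOpK_of_pos C Ω A hm ha hL hj)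
    (isUnit_covOpK_of_pos C Ω A hm ha hL (by omega))

/-- **(2.43) = B4 (2.34) FOR THE CONCRETE MODEL.**  For m² > 0, a > 0, L > 1, 1 ≤ k ≤ K, every external vector field `A` on
`T_ε`, every region `Ω ⊂ T_ε` and every coupling `U(A) = exp(qεeA)`:
`G^ε_k(Ω,A) = Σ_{j=1}^{k−1} a_j²(L^jε)^{−4} G^ε_j(Ω,A)Q^*_j(A)C^{(j),L^jε}(Ω,A)Q_j(A)G^ε_j(Ω,A) + C^{(0),ε}(Ω,A)` — the printed
identity for Bałaban's actual covariant operators (2.7)/(2.11)/(2.17)/(2.20)/(2.30), UNCONDITIONALLY.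
[cite: Balaban1982Higgs1, (2.43) p.612; Balaban1983RegularityDecay, (2.34) p.582] -/
theorem display243_model (hm : 0 < msq) (ha : 0 < a) (hL : 1 < (P.L : ℝ)) {k : ℕ} (hk : 1 ≤ k) (hkK : k ≤ P.K) :
    propagatorK C Ω A msq a k
      = (∑ j ∈ Finset.Ico 1 k, (coeff221 P a j ^ 2) •
          (propagatorK C Ω A msq a j ∘ₗ avgQkAdj C A j ∘ₗ fluctCovA C Ω A msq a j ∘ₗ avgQkLin C A j
            ∘ₗ propagatorK C Ω A msq a j))
        + fluctCovA C Ω A msq a 0 :=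
  display243_of_isUnit C Ω A hm.le ha hL hk hkK fun _ hj _ => isUnit_covOpK_of_pos C Ω A hm ha hL hj

/-- **[Balaban1983RegularityDecay] (2.34) = (2.43) «rescaled to the η-lattice»**: the same identity for the RESCALED
propagators `G_k(Ω,A) = (−Δ^{η,N}_{A,Ω} + m²(L^kε)² + a_kP_k(A))^{−1}` of (2.22) (`HiggsCovariance.propagatorRescaled`: the
construction over the η-lattice parameters `P.unitAt k`, mass `m²(L^kε)²`), 1 ≤ k ≤ K, m² > 0 — B4's `G_k(□)` is the case
`A = 0`, `Ω = □`. [cite: Balaban1983RegularityDecay, (2.34) p.582; Balaban1982Higgs1, (2.22) p.610] -/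
theorem display234_rescaled (hm : 0 < msq) (ha : 0 < a) (hL : 1 < (P.L : ℝ)) {k : ℕ} (hk : 1 ≤ k) (hkK : k ≤ P.K)
    (Ω' : Finset (HiggsLattice.Site (P.unitAt k) 0)) (A' : HiggsLattice.VecField (P.unitAt k) 0) :
    propagatorRescaled P C k Ω' A' msq a
      = (∑ j ∈ Finset.Ico 1 k, (coeff221 (P.unitAt k) a j ^ 2) •
          (propagatorK C Ω' A' (msq * P.mesh k ^ 2) a j ∘ₗ avgQkAdj C A' j ∘ₗ fluctCovA C Ω' A' (msq * P.mesh k ^ 2) a j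
            ∘ₗ avgQkLin C A' j ∘ₗ propagatorK C Ω' A' (msq * P.mesh k ^ 2) a j))
        + fluctCovA C Ω' A' (msq * P.mesh k ^ 2) a 0 :=
  display243_model (P := P.unitAt k) C Ω' A' (mul_pos hm (pow_pos (P.mesh_pos k) 2)) ha hL hk hkK

/-- The printed coefficient: `coeff221 P a j ^ 2 = a_j²(L^jε)^{−4}`. [cite: Balaban1982Higgs1, (2.43) p.612] -/
theorem coeff221_sq (a : ℝ) (j : ℕ) : coeff221 P a j ^ 2 = B1.aSeq a P.L j ^ 2 * (P.mesh j ^ 4)⁻¹ := by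
  rw [coeff221_eq, mul_pow, ← inv_pow, ← pow_mul]

end RG

/-! ## §5 Covariantly constant fields are transported to their endpoint values along the contours (2.1)/(2.2) -/

section MasslessTransport

variable (C : ChargeData N) (A : HiggsLattice.VecField P 0)

/-- If `(D^ε_Aφ)(b) = 0` on every bond of `T_ε`, then along the staircase contour (2.1) `U(A(Γ_{y,x}))φ(x) = φ(y)` — the
case `p = 0` of the telescoping estimate of II p. 559 (`B2Restr216Lattice.norm_U_contourSum_cornerN_sub_le`).
[cite: Balaban1982Higgs1, (2.1) p.608] -/
theorem U_contourSum_apply_of_covDeriv_eq_zero (φ : ScalarField P 0 N) (hφ : ∀ b, covDeriv C A φ b = 0)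
    (y x : HiggsLattice.Site P 0) : C.U (P.mesh 0) (contourSum A y x) (φ x) = φ y := by
  have hD : ∀ b, covDiff C A φ b = 0 := fun b => by rw [covDiff_eq_smul_covDeriv, hφ, smul_zero]
  have h := norm_U_contourSum_cornerN_sub_le C A φ y x
    (m := Finset.univ.sup fun t : Fin P.d => (x t - y t).val) (p := 0) le_rfl
    (fun t => Finset.le_sup (f := fun t : Fin P.d => (x t - y t).val) (Finset.mem_univ t))
    (fun t j _ => by rw [hD, norm_zero]) P.d le_rfl
  rw [cornerN_d, mul_zero, mul_zero] at h
  exact sub_eq_zero.mp (norm_le_zero_iff.mp h)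

/-- Along the composite contour (2.2): `U(A(Γ^{(k)}_{x_k,x}))φ(x) = φ(x_k)` (`x_k ∈ T^{(k)} ⊂ T_ε` the block point of `x`)
for a covariantly constant `φ`. [cite: Balaban1982Higgs1, (2.2) p.608] -/
theorem U_multiContourSum_apply_of_covDeriv_eq_zero (φ : ScalarField P 0 N) (hφ : ∀ b, covDeriv C A φ b = 0)
    (k : ℕ) (x : HiggsLattice.Site P 0) :
    C.U (P.mesh 0) (multiContourSum A k x) (φ x) = φ (toFinest (blockIter k x)) := by
  induction k with
  | zero =>
    rw [multiContourSum_zero, ChargeData.U_zero, one_apply_eq_self]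
    show φ x = φ (toFinest x)
    rw [toFinest_zero]
  | succ k ih =>
    rw [multiContourSum_succ, add_comm, ChargeData.U_add, mul_apply_eq_comp, ih,
      U_contourSum_apply_of_covDeriv_eq_zero C A φ hφ]

/-- `Q_k(A)` (2.11) on a covariantly constant field: every term of `(Q_k(A)φ)(y)` equals `φ(y)`, so
`(Q_k(A)φ)(y) = L^{−kd}·|B^k(y)|·φ(y)`. [cite: Balaban1982Higgs1, (2.11) p.609] -/
theorem avgQkLin_apply_of_covDeriv_eq_zero (φ : ScalarField P 0 N) (hφ : ∀ b, covDeriv C A φ b = 0) (k : ℕ)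
    (y : HiggsLattice.Site P k) :
    avgQkLin C A k φ y = (((P.L : ℝ) ^ (k * P.d))⁻¹) • (((blockK k y).card : ℝ) • φ (toFinest y)) := by
  rw [avgQkLin_apply, avgQk_apply, Nat.cast_smul_eq_nsmul, ← Finset.sum_const]
  congr 1
  refine Finset.sum_congr rfl fun x hx => ?_
  rw [U_multiContourSum_apply_of_covDeriv_eq_zero C A φ hφ k x, (mem_blockK k y x).mp hx]

end MasslessTransport

/-! ## §6 (1.6)/(2.20) on the whole torus for m² ≥ 0: the operator is injective, `G^ε_k(T_ε, A)` exists -/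

section MasslessExistence

variable (C : ChargeData N) (A : HiggsLattice.VecField P 0) {msq a : ℝ} {k : ℕ}

/-- The quadratic form of the operator of (2.20)/(1.6): `⟨φ, (−Δ^{ε,N}_{A,Ω} + m² + a_k(L^kε)^{−2}P_k(A))φ⟩ =
⟨φ, −Δ^{ε,N}_{A,Ω}φ⟩ + m²⟨φ,φ⟩ + a_k(L^kε)^{−2}⟨Q_k(A)φ, Q_k(A)φ⟩` ((1.5): `P_k = Q_k^*Q_k`). [cite: Balaban1983RegularityDecay, (1.6) p.572] -/
theorem siteInner_covOpK_eq (Ω : Finset (HiggsLattice.Site P 0)) (msq a : ℝ) (k : ℕ) (φ : ScalarField P 0 N) :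
    siteInner φ (covOpK C Ω A msq a k φ)
      = siteInner φ (covLaplacianN C Ω A φ) + msq * siteInner φ φ
        + (B1.aSeq a P.L k * ((P.mesh k)⁻¹ ^ 2)) * siteInner (avgQkLin C A k φ) (avgQkLin C A k φ) := by
  rw [← siteInner_projPk]
  unfold covOpK siteInner
  simp only [LinearMap.add_apply, LinearMap.smul_apply, LinearMap.id_coe, id_eq, Pi.add_apply, Pi.smul_apply,
    inner_add_right, real_inner_smul_right, mul_add, Finset.sum_add_distrib, Finset.mul_sum]
  congr 1
  · congr 1
    exact Finset.sum_congr rfl fun x _ => by ring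
  · exact Finset.sum_congr rfl fun x _ => by ring

/-- On the whole torus a kernel vector of (1.6)/(2.20) (m² ≥ 0, a_k > 0) is covariantly constant and has vanishing
averages: `D^ε_Aφ = 0` and `Q_k(A)φ = 0` (all three terms of the form are ≥ 0; (1.3) on T is `Σ_b ε^d|D^ε_Aφ(b)|²`).
[cite: Balaban1983RegularityDecay, (1.6) p.572] -/
theorem covDeriv_eq_zero_of_covOpK_univ_eq_zero (hmsq : 0 ≤ msq) (hak : 0 < B1.aSeq a P.L k) {φ : ScalarField P 0 N}
    (hφ : covOpK C Finset.univ A msq a k φ = 0) : (∀ b, covDeriv C A φ b = 0) ∧ avgQkLin C A k φ = 0 := by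
  have hq := siteInner_covOpK_eq C A Finset.univ msq a k φ
  rw [hφ, siteInner_covLaplacianN_univ_self] at hq
  have h0 : siteInner φ (0 : ScalarField P 0 N) = 0 := by simp [siteInner]
  rw [h0] at hq
  have h1 : 0 ≤ covLaplaceForm C A φ :=
    Finset.sum_nonneg fun b _ => mul_nonneg (pow_nonneg (P.mesh_pos 0).le _) (sq_nonneg _)
  have h2 : 0 ≤ msq * siteInner φ φ := mul_nonneg hmsq (siteInner_self_nonneg φ)
  have hc : 0 < B1.aSeq a P.L k * ((P.mesh k)⁻¹ ^ 2) := mul_pos hak (pow_pos (inv_pos.mpr (P.mesh_pos k)) 2)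
  have h3 : 0 ≤ (B1.aSeq a P.L k * ((P.mesh k)⁻¹ ^ 2)) * siteInner (avgQkLin C A k φ) (avgQkLin C A k φ) :=
    mul_nonneg hc.le (siteInner_self_nonneg _)
  have hlap : covLaplaceForm C A φ = 0 := by linarith
  have havg : siteInner (avgQkLin C A k φ) (avgQkLin C A k φ) = 0 := by
    have h : (B1.aSeq a P.L k * ((P.mesh k)⁻¹ ^ 2)) * siteInner (avgQkLin C A k φ) (avgQkLin C A k φ) = 0 := by
      linarith
    rcases mul_eq_zero.mp h with h | h
    · exact absurd h hc.ne'
    · exact h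
  refine ⟨fun b => ?_, eq_zero_of_siteInner_self_eq_zero _ havg⟩
  unfold covLaplaceForm at hlap
  have hterm := (Finset.sum_eq_zero_iff_of_nonneg fun b _ =>
    mul_nonneg (pow_nonneg (P.mesh_pos 0).le _) (sq_nonneg _)).mp hlap b (Finset.mem_univ b)
  rcases mul_eq_zero.mp hterm with h | h
  · exact absurd h (pow_ne_zero _ (P.mesh_pos 0).ne')
  · exact norm_eq_zero.mp ((pow_eq_zero_iff two_ne_zero).mp h)

/-- **(1.6)/(2.20) on the whole torus, m² ≥ 0, a_k > 0: the operator `−Δ^{ε,N}_{A,T} + m² + a_k(L^kε)^{−2}P_k(A)` is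
injective** for EVERY vector field `A` — a kernel vector is covariantly constant with `Q_k(A)φ = 0`, so by §5 it vanishes at
every block point `x_k` and `|φ(x)| = |U(A(Γ^{(k)}_{x_k,x}))φ(x)| = |φ(x_k)| = 0`. [cite: Balaban1983RegularityDecay, (1.6) p.572] -/
theorem covOpK_univ_injective (hmsq : 0 ≤ msq) (hak : 0 < B1.aSeq a P.L k) :
    Function.Injective (covOpK C Finset.univ A msq a k) := by
  refine (injective_iff_map_eq_zero _).mpr fun φ hφ => ?_
  obtain ⟨hD, hQ⟩ := covDeriv_eq_zero_of_covOpK_univ_eq_zero C A hmsq hak hφ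
  have hpt : ∀ x : HiggsLattice.Site P 0, φ (toFinest (blockIter k x)) = 0 := by
    intro x
    have hx : x ∈ blockK k (blockIter k x) := (mem_blockK k _ x).mpr rfl
    have hcard : ((blockK k (blockIter k x)).card : ℝ) ≠ 0 :=
      Nat.cast_ne_zero.mpr (Finset.card_ne_zero.mpr ⟨x, hx⟩)
    have h := avgQkLin_apply_of_covDeriv_eq_zero C A φ hD k (blockIter k x)
    rw [hQ, Pi.zero_apply] at h
    rcases smul_eq_zero.mp h.symm with h1 | h1
    · exact absurd h1 (inv_ne_zero (pow_ne_zero _ (by exact_mod_cast P.hL.ne')))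
    · rcases smul_eq_zero.mp h1 with h2 | h2
      · exact absurd h2 hcard
      · exact h2
  funext x
  have h := norm_U_apply C (P.mesh 0) (multiContourSum A k x) (φ x)
  rw [U_multiContourSum_apply_of_covDeriv_eq_zero C A φ hD k x, hpt x, norm_zero] at h
  exact norm_eq_zero.mp h.symm

/-- **B4 (1.6) = B1 (2.20) EXISTS on the whole torus for m² ≥ 0, a_k > 0**: the operator is a unit of the endomorphism
ring of the fields on `T_ε` (injective endomorphism of a finite-dimensional space), for every external vector field `A`
and every coupling `U(A) = exp(qηeA)`. [cite: Balaban1983RegularityDecay, (1.6) p.572] -/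
theorem isUnit_covOpK_univ (hmsq : 0 ≤ msq) (hak : 0 < B1.aSeq a P.L k) :
    IsUnit (covOpK C Finset.univ A msq a k) := by
  rw [LinearMap.isUnit_iff_ker_eq_bot]
  exact LinearMap.ker_eq_bot.mpr (covOpK_univ_injective C A hmsq hak)

/-- The paper's hypotheses `a > 0`, `L > 1`, `k ≥ 1` give `a_k > 0` ((2.15), `B1.aSeq_pos`): `G^ε_k(T_ε, A)` exists for every
`m² ≥ 0`. [cite: Balaban1983RegularityDecay, (1.6) p.572] -/
theorem isUnit_covOpK_univ_of_pos (hmsq : 0 ≤ msq) (ha : 0 < a) (hL : 1 < (P.L : ℝ)) (hk : 1 ≤ k) :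
    IsUnit (covOpK C Finset.univ A msq a k) :=
  isUnit_covOpK_univ C A hmsq (B1.aSeq_pos ha hL hk)

/-- `G^ε_k(T_ε, A) ∘ (−Δ^ε_A + m² + a_k(L^kε)^{−2}P_k(A)) = 1`, m² ≥ 0, a_k > 0. [cite: Balaban1982Higgs1, (2.20) p.610] -/
theorem propagatorK_mul_covOpK_univ (hmsq : 0 ≤ msq) (hak : 0 < B1.aSeq a P.L k) :
    propagatorK C Finset.univ A msq a k * covOpK C Finset.univ A msq a k = 1 :=
  Ring.inverse_mul_cancel _ (isUnit_covOpK_univ C A hmsq hak)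

/-- `(−Δ^ε_A + m² + a_k(L^kε)^{−2}P_k(A)) ∘ G^ε_k(T_ε, A) = 1`, m² ≥ 0, a_k > 0. [cite: Balaban1982Higgs1, (2.20) p.610] -/
theorem covOpK_mul_propagatorK_univ (hmsq : 0 ≤ msq) (hak : 0 < B1.aSeq a P.L k) :
    covOpK C Finset.univ A msq a k * propagatorK C Finset.univ A msq a k = 1 :=
  Ring.mul_inverse_cancel _ (isUnit_covOpK_univ C A hmsq hak)

end MasslessExistence

/-! ## §7 (2.41)–(2.43) = B4 (2.34) on the whole torus in the full printed range m² ≥ 0 -/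

section MasslessRG

variable (C : ChargeData N) (A : HiggsLattice.VecField P 0) {msq a : ℝ}

/-- **(2.42) on the whole torus, m² ≥ 0**, a > 0, L > 1, 1 ≤ j < K, every `A`, `C`. [cite: Balaban1982Higgs1, (2.42) p.612] -/
theorem display242_univ (hm : 0 ≤ msq) (ha : 0 < a) (hL : 1 < (P.L : ℝ)) {j : ℕ} (hj : 1 ≤ j) (hjK : j < P.K) :
    propagatorK C Finset.univ A msq a (j + 1)
      = (coeff221 P a j ^ 2) • (propagatorK C Finset.univ A msq a j ∘ₗ avgQkAdj C A j
          ∘ₗ fluctCovA C Finset.univ A msq a j ∘ₗ avgQkLin C A j ∘ₗ propagatorK C Finset.univ A msq a j)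
        + propagatorK C Finset.univ A msq a j :=
  display242_of_isUnit C Finset.univ A hm ha hL hj hjK (isUnit_covOpK_univ_of_pos C A hm ha hL hj)
    (isUnit_covOpK_univ_of_pos C A hm ha hL (by omega))

/-- **(2.41) on the whole torus, m² ≥ 0**, a > 0, L > 1, 1 ≤ j < K, every `A`, `C`. [cite: Balaban1982Higgs1, (2.41) p.612] -/
theorem display241_univ (hm : 0 ≤ msq) (ha : 0 < a) (hL : 1 < (P.L : ℝ)) {j : ℕ} (hj : 1 ≤ j) (hjK : j < P.K) :
    avgQkLin C A (j + 1) ∘ₗ propagatorK C Finset.univ A msq a (j + 1)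
      = (a * B1.aSeq a P.L j / B1.aSeq a P.L (j + 1) * (P.mesh j ^ 2)⁻¹) •
          (avgQLin C A j ∘ₗ fluctCovA C Finset.univ A msq a j ∘ₗ avgQkLin C A j
            ∘ₗ propagatorK C Finset.univ A msq a j) :=
  display241_of_isUnit C Finset.univ A hm ha hL hj hjK (isUnit_covOpK_univ_of_pos C A hm ha hL hj)
    (isUnit_covOpK_univ_of_pos C A hm ha hL (by omega))

/-- **(2.43) = B4 (2.34) on the whole torus in the printed range m² ≥ 0** (a > 0, L > 1, 1 ≤ k ≤ K; every external
vector field `A`, every coupling): `G^ε_k(T,A) = Σ_{j=1}^{k−1} a_j²(L^jε)^{−4} G^ε_j(T,A)Q^*_j(A)C^{(j),L^jε}(T,A)Q_j(A)G^ε_j(T,A)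
+ C^{(0),ε}(T,A)`. [cite: Balaban1982Higgs1, (2.43) p.612; Balaban1983RegularityDecay, (2.34) p.582] -/
theorem display243_univ (hm : 0 ≤ msq) (ha : 0 < a) (hL : 1 < (P.L : ℝ)) {k : ℕ} (hk : 1 ≤ k) (hkK : k ≤ P.K) :
    propagatorK C Finset.univ A msq a k
      = (∑ j ∈ Finset.Ico 1 k, (coeff221 P a j ^ 2) •
          (propagatorK C Finset.univ A msq a j ∘ₗ avgQkAdj C A j ∘ₗ fluctCovA C Finset.univ A msq a j
            ∘ₗ avgQkLin C A j ∘ₗ propagatorK C Finset.univ A msq a j))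
        + fluctCovA C Finset.univ A msq a 0 :=
  display243_of_isUnit C Finset.univ A hm ha hL hk hkK fun _ hj _ => isUnit_covOpK_univ_of_pos C A hm ha hL hj

/-- **B4 (2.34) for the RESCALED propagators (2.22) on the whole η-torus, m² ≥ 0** (`HiggsCovariance.propagatorRescaled`,
parameters `P.unitAt k`, mass m²(L^kε)²), 1 ≤ k ≤ K. [cite: Balaban1983RegularityDecay, (2.34) p.582; Balaban1982Higgs1, (2.22) p.610] -/
theorem display234_rescaled_univ (hm : 0 ≤ msq) (ha : 0 < a) (hL : 1 < (P.L : ℝ)) {k : ℕ} (hk : 1 ≤ k) (hkK : k ≤ P.K)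
    (A' : HiggsLattice.VecField (P.unitAt k) 0) :
    propagatorRescaled P C k Finset.univ A' msq a
      = (∑ j ∈ Finset.Ico 1 k, (coeff221 (P.unitAt k) a j ^ 2) •
          (propagatorK C Finset.univ A' (msq * P.mesh k ^ 2) a j ∘ₗ avgQkAdj C A' j
            ∘ₗ fluctCovA C Finset.univ A' (msq * P.mesh k ^ 2) a j ∘ₗ avgQkLin C A' j
            ∘ₗ propagatorK C Finset.univ A' (msq * P.mesh k ^ 2) a j))
        + fluctCovA C Finset.univ A' (msq * P.mesh k ^ 2) a 0 :=
  display243_univ (P := P.unitAt k) C A' (mul_nonneg hm (sq_nonneg _)) ha hL hk hkK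

end MasslessRG

end Literature.MathematicalPhysics.QuantumFieldTheory.Balaban1983to89.B1Eq243HiggsModel
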